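import Summits.AtomisticToContinuum.HydrodynamicLimit.Theorems.CollisionIsometryCLTCollisionalTransferLocalityItemsAssemblyC10
import Summits.AtomisticToContinuum.HydrodynamicLimit.Theorems.CollisionIsometryCLTCollisionalTransferLocalityDefsF
import Summits.AtomisticToContinuum.HydrodynamicLimit.Theses.CollisionIsometryCLT
import HarnessLib

/-!
# Split glue for crux `CollisionalTransferLocality` (stmt-AtomisticToContinuum-9518) on route CollisionIsometryCLT (rev 15) — the filed `∀ t` crux from its six split children, and the proof of the glue item stmt-18220
(crux-strategist decomposition, 2026-08-17; PROVER-READY: propose verbatim as `Theorems/CollisionIsometryCLTCollisionalTransferLocalityGlue.lean --workitem stmt-AtomisticToContinuum-18220`)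

`collisionalTransferLocality_of_subs : FastMomentRelaxation → ⟨CollisionMomentBound⟩ → ⟨EvenStressEnskog⟩ → ⟨TwoScaleValueRegularity⟩ →
⟨CollisionalEnergyFluxLaw⟩ → ⟨MesoscaleDiluteCeilingAllTimes⟩ → StiffCollisionalRelaxation.CollisionalTransferLocality`, where every ⟨·⟩ is
written as the VERBATIM route-vocabulary text filed as a split child of 9518 (so that the generated glue item of the split is closed by
`fun h₁ … h₆ => collisionalTransferLocality_of_subs h₁ … h₆` up to definitional unfolding of the route decls). No new mathematics: it is the
lead's landed assembly `HemisphereAffineSlaving.collisionalTransferLocality_of_items_c10` (p148188: seats c2–c10 of line hemisphere-affine-slaving)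
composed with the landed inline↔line certificates `twoScaleValueRegularity_iff_inline` (DefsF, p147626) and `collisionalEnergyFluxLaw_iff_inline`
(DefsD, p140233); texts 2 and 3 are verbatim the items stmt-15144 (`InformationPercolationEngine.CollisionMomentBound`) and stmt-13079
(`JParityClosure.EvenStressEnskog`), consumed by definitional unfolding.
-/

namespace Summit.AtomisticToContinuum.HydrodynamicLimit.Theorems

open scoped BigOperators Topology Classical ENNReal InnerProductSpace
open Filter Set Function MeasureTheory

noncomputable section

/-- **Split glue (crux-strategist, 2026-08-17).** The filed `∀ t` crux `StiffCollisionalRelaxation.CollisionalTransferLocality` (=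
`CollisionIsometryCLT.CollisionalTransferLocality`, `rfl`) from: (1) the kinetic hinge stmt-9522 `FastMomentRelaxation` (verbatim text); (2) the
collision-moment tightness stmt-15144 (verbatim text); (3) the J-even contact statistics stmt-13079 `EvenStressEnskog` (verbatim text); (4) [TS] the
one-body two-scale regularity of the collisional-pressure value functional (`TwoScaleValueRegularityInline`, let-compressed below the 4000-char item cap; `Iff.rfl`); (5) [Kq] the mesoscale
collisional-energy-flux law (`CollisionalEnergyFluxLawInline`, let-compressed; `Iff.rfl`); (6) [S'] the `∀ t` mesoscale dilute ceiling (registered stub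
`stub_ceilingAllTimes`, inlined). Proof: the lead's `collisionalTransferLocality_of_items_c10` after the two `_iff_inline` certificates. -/
theorem collisionalTransferLocality_of_subs_cic :
    (∀ (a₀ θ₀ : (UnitAddTorus (Fin 3)) → ℝ) (u₀ : (UnitAddTorus (Fin 3)) → (EuclideanSpace ℝ (Fin 3))), Continuous a₀ → Continuous θ₀ → Continuous u₀ → (∀ x, 0 < a₀ x) → (∀ x, 0 < θ₀ x) → ∃ σ₀ : ℝ, 0 < σ₀ ∧ ∀ σ : ℝ, 0 < σ → σ < σ₀ → ∀ Φ : (N : ℕ) → Literature.Analysis.FluidPDE.HardSphereFlow (Literature.Analysis.FluidPDE.Torus.geometry (Fin 3)) (Literature.MathematicalPhysics.KineticTheory.hsDiameter σ N) (N + 1), ∀ (γ C : ℝ) (φ : ℕ → (UnitAddTorus (Fin 3)) → ℝ), 0 < γ → γ ≤ 1 / 15 → ((∀ N, Literature.Analysis.FunctionSpaces.Torus.IsSmooth (φ N)) ∧ (∀ N y, 0 ≤ φ N y) ∧ (∀ N, ∫ y, φ N y = 1) ∧ (∀ (N : ℕ) y, ((N : ℝ) + 1) ^ (-γ) ≤ Literature.Analysis.FluidPDE.Torus.euclidDist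 y 0 → φ N y = 0) ∧ (∀ (N : ℕ) y, φ N y ≤ C * ((N : ℝ) + 1) ^ (3 * γ)) ∧ (∀ (N : ℕ) y, ‖Literature.Analysis.FunctionSpaces.Torus.gradient (φ N) y‖ ≤ C * ((N : ℝ) + 1) ^ (4 * γ))) → let ρb := fun (N : ℕ) (z : Literature.Analysis.FluidPDE.Config (N + 1) (Fin 3) (UnitAddTorus (Fin 3))) (x : (UnitAddTorus (Fin 3))) => Literature.MathematicalPhysics.KineticTheory.empiricalDensityField z (fun y => φ N (y - x)); let mb := fun (N : ℕ) (z : Literature.Analysis.FluidPDE.Config (N + 1) (Fin 3) (UnitAddTorus (Fin 3))) (x : (UnitAddTorus (Fin 3))) => Literature.MathematicalPhysics.KineticTheory.empiricalMomentumField z (fun y => φ N (y - x)); let ub := fun (N : ℕ) (z : Literature.Analysis.FluidPDE.Config (N + 1) (Fin 3) (UnitAddTorus (Fin 3))) (x : (UnitAddTorus (Fin 3))) => (ρb N z x)⁻¹ • mb N z x; let D := fun (N : ℕ) (z : Literature.Analysis.FluidPDE.Config (N + 1) (Fin 3) (UnitAddTorus (Fin 3))) (x : (UnitAddTorus (Fin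 3))) (j k : Fin 3) => (∫ y, φ N (y.1 - x) * ((y.2 j - ub N z x j) * (y.2 k - ub N z x k)) ∂(Literature.Analysis.FluidPDE.empiricalMeasure z)) - (if j = k then (∑ l : Fin 3, ∫ y, φ N (y.1 - x) * (y.2 l - ub N z x l) ^ 2 ∂(Literature.Analysis.FluidPDE.empiricalMeasure z)) / 3 else 0); let q := fun (N : ℕ) (z : Literature.Analysis.FluidPDE.Config (N + 1) (Fin 3) (UnitAddTorus (Fin 3))) (x : (UnitAddTorus (Fin 3))) => ∫ y, (φ N (y.1 - x) * ‖y.2 - ub N z x‖ ^ 2 / 2) • (y.2 - ub N z x) ∂(Literature.Analysis.FluidPDE.empiricalMeasure z); ∀ t : ℝ, 0 < t → ∀ δ : ℝ, 0 < δ → Tendsto (fun N : ℕ => Literature.MathematicalPhysics.KineticTheory.localGibbsLaw σ a₀ u₀ θ₀ N (Φ N) {z | δ < ∫ s in Icc 0 t, ∫ x, ((∑ j, ∑ k, D N ((Φ N).flow s z) x j k ^ 2) + ‖q N ((Φ N).flow s z) x‖ ^ 2)}) atTop (𝓝 0)) →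
    (∀ (a₀ θ₀ : Literature.MathematicalPhysics.KineticTheory.T3 → ℝ) (u₀ : Literature.MathematicalPhysics.KineticTheory.T3 → Literature.MathematicalPhysics.KineticTheory.V3), Continuous a₀ → Continuous θ₀ → Continuous u₀ → (∀ x, 0 < a₀ x) → (∀ x, 0 < θ₀ x) → ∃ σ₀ : ℝ, 0 < σ₀ ∧ ∀ σ : ℝ, 0 < σ → σ < σ₀ → ∀ Φ : (N : ℕ) → Literature.Analysis.FluidPDE.HardSphereFlow (Literature.Analysis.FluidPDE.Torus.geometry (Fin 3)) (Literature.MathematicalPhysics.KineticTheory.hsDiameter σ N) (N + 1), ∀ τ : ℝ, 0 < τ → ∀ δ : ℝ, 0 < δ → ∃ Kb : ℝ, ∃ N₀ : ℕ, ∀ N : ℕ, N₀ ≤ N → let ε := Literature.MathematicalPhysics.KineticTheory.hsDiameter σ N; let G : Literature.Analysis.FluidPDE.Geometry (Fin 3) Literature.MathematicalPhysics.KineticTheory.T3 := Literature.Analysis.FluidPDE.Torus.geometry (Fin 3); let γ : Literature.Analysis.FluidPDE.Config (N + 1) (Fin 3) Literature.MathematicalPhysics.KineticTheory.T3 → ℝ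 → Literature.Analysis.FluidPDE.Config (N + 1) (Fin 3) Literature.MathematicalPhysics.KineticTheory.T3 := fun z s => (Φ N).flow s z; let Kc : (Literature.Analysis.FluidPDE.Config (N + 1) (Fin 3) Literature.MathematicalPhysics.KineticTheory.T3 → ℝ → Fin (N + 1) → Fin (N + 1) → ℝ) → Literature.Analysis.FluidPDE.Config (N + 1) (Fin 3) Literature.MathematicalPhysics.KineticTheory.T3 → ℝ := fun F z => ε / (N + 1 : ℝ) * ∑ᶠ (s : ℝ) (_ : s ∈ Literature.Analysis.FluidPDE.collisionTimes G ε (γ z) ∩ Set.Icc 0 τ), ∑ i : Fin (N + 1), ∑ j : Fin (N + 1), (if i ≠ j ∧ ‖G.sepVec (γ z s i).1 (γ z s j).1‖ = ε then F z s i j else 0); Literature.MathematicalPhysics.KineticTheory.localGibbsLaw σ a₀ u₀ θ₀ N (Φ N) {z | Kb < Kc (fun z s i j => 1 + ‖(γ z s i).2‖ ^ 2 + ‖(γ z s j).2‖ ^ 2) z} ≤ ENNReal.ofReal δ) →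
    (∃ η₀ : ℝ, 0 < η₀ ∧ ∀ (a₀ θ₀ : Literature.MathematicalPhysics.KineticTheory.T3 → ℝ) (u₀ : Literature.MathematicalPhysics.KineticTheory.T3 → Literature.MathematicalPhysics.KineticTheory.V3), Continuous a₀ → Continuous θ₀ → Continuous u₀ → (∀ x, 0 < a₀ x) → (∀ x, 0 < θ₀ x) → ∃ σ₀ : ℝ, 0 < σ₀ ∧ ∀ σ : ℝ, 0 < σ → σ < σ₀ → ∀ Φ : (N : ℕ) → Literature.Analysis.FluidPDE.HardSphereFlow (Literature.Analysis.FluidPDE.Torus.geometry (Fin 3)) (Literature.MathematicalPhysics.KineticTheory.hsDiameter σ N) (N + 1), ∀ τ : ℝ, 0 < τ → ∀ χ : ℝ × UnitAddTorus (Fin 3) → ℝ, Continuous χ → ∀ g : ℝ → ℝ, Continuous g → (∀ a, η₀ ≤ a → g a = 0) → ∀ η δ : ℝ, 0 < η → 0 < δ → ∃ r₀ : ℝ, 0 < r₀ ∧ ∀ r : ℝ, 0 < r → r < r₀ → ∃ N₀ : ℕ, ∀ N : ℕ, N₀ ≤ N → let ε := Literature.MathematicalPhysics.KineticTheory.hsDiameter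 σ N; let G := Literature.Analysis.FluidPDE.Torus.geometry (Fin 3); let γ := fun z (s : ℝ) => (Φ N).flow s z; let bx : UnitAddTorus (Fin 3) → UnitAddTorus (Fin 3) → ℝ := fun x y => 3 / (Real.pi * r ^ 3) * max (1 - Literature.Analysis.FluidPDE.Torus.euclidDist x y / r) 0; let ρm := fun z s (x₀ : UnitAddTorus (Fin 3)) => ∫ q, bx q.1 x₀ ∂(Literature.Analysis.FluidPDE.empiricalMeasure (γ z s)); let Θ := fun (Ξ : EuclideanSpace ℝ (Fin 3) × EuclideanSpace ℝ (Fin 3) × EuclideanSpace ℝ (Fin 3) → ℝ) (v w : EuclideanSpace ℝ (Fin 3)) => ∫ ω : Metric.sphere (0 : EuclideanSpace ℝ (Fin 3)) 1, Ξ ((ω : EuclideanSpace ℝ (Fin 3)), v, w) * Literature.MathematicalPhysics.KineticTheory.hardSphereKernel (w, v) ω ∂Literature.MathematicalPhysics.KineticTheory.sphereMeasure; let B := fun Ξ z s (x₀ : UnitAddTorus (Fin 3)) => ∫ p, bx p.1.1 x₀ * bx p.2.1 x₀ * Θ Ξ p.1.2 p.2.2 ∂((Literature.Analysis.FluidPDE.empiricalMeasure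 (γ z s)).prod (Literature.Analysis.FluidPDE.empiricalMeasure (γ z s))); let pv := fun z s (i j : Fin (N + 1)) => Literature.Analysis.FluidPDE.reflectVel (G.sepVec (γ z s i).1 (γ z s j).1) ((γ z s i).2, (γ z s j).2); let Kc := fun (Fn : Literature.Analysis.FluidPDE.Config (N + 1) (Fin 3) Literature.MathematicalPhysics.KineticTheory.T3 → ℝ → Fin (N + 1) → Fin (N + 1) → ℝ) z => ε / (N + 1 : ℝ) * ∑ᶠ (s : ℝ) (_ : s ∈ Literature.Analysis.FluidPDE.collisionTimes G ε (γ z) ∩ Set.Icc 0 τ), ∑ i : Fin (N + 1), ∑ j : Fin (N + 1), (if i ≠ j ∧ ‖G.sepVec (γ z s i).1 (γ z s j).1‖ = ε then Fn z s i j else 0); let Y : ℝ → ℝ := fun a => 3 / (2 * Real.pi) * deriv Literature.MathematicalPhysics.KineticTheory.hsExcessFreeEnergy a; let Dm := fun (Ξ : EuclideanSpace ℝ (Fin 3) × EuclideanSpace ℝ (Fin 3) × EuclideanSpace ℝ (Fin 3) → ℝ) z => Kc (fun z s i j => χ (s, (γ z s i).1) * g (σ ^ 3 * ρm z s (γ z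 s i).1) * Ξ (ε⁻¹ • G.sepVec (γ z s i).1 (γ z s j).1, (pv z s i j).1, (pv z s i j).2)) z - σ ^ 3 * ∫ s in Set.Icc (0 : ℝ) τ, ∫ x : UnitAddTorus (Fin 3), χ (s, x) * g (σ ^ 3 * ρm z s x) * Y (σ ^ 3 * ρm z s x) * B Ξ z s x; let ΞP := fun (k l : Fin 3) (q : EuclideanSpace ℝ (Fin 3) × EuclideanSpace ℝ (Fin 3) × EuclideanSpace ℝ (Fin 3)) => max ⟪q.2.2 - q.2.1, q.1⟫_ℝ 0 * (q.1 k * q.1 l); ∀ k l : Fin 3, Literature.MathematicalPhysics.KineticTheory.localGibbsLaw σ a₀ u₀ θ₀ N (Φ N) {z | η < |Dm (ΞP k l) z|} ≤ ENNReal.ofReal δ) →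
    (∀ (a₀ θ₀ : (UnitAddTorus (Fin 3)) → ℝ) (u₀ : (UnitAddTorus (Fin 3)) → (EuclideanSpace ℝ (Fin 3))), Continuous a₀ → Continuous θ₀ → Continuous u₀ → (∀ x, 0 < a₀ x) → (∀ x, 0 < θ₀ x) → ∃ σ₀ : ℝ, 0 < σ₀ ∧ ∃ η₁ : ℝ, 0 < η₁ ∧ ∀ σ : ℝ, 0 < σ → σ < σ₀ → ∀ Φ : (N : ℕ) → Literature.Analysis.FluidPDE.HardSphereFlow (Literature.Analysis.FluidPDE.Torus.geometry (Fin 3)) (Literature.MathematicalPhysics.KineticTheory.hsDiameter σ N) (N + 1), ∀ t : ℝ, 0 < t → ∀ (γ C : ℝ) (φ : ℕ → (UnitAddTorus (Fin 3)) → ℝ), 0 < γ → γ ≤ 1 / 15 → ((∀ N, Literature.Analysis.FunctionSpaces.Torus.IsSmooth (φ N)) ∧ (∀ N y, 0 ≤ φ N y) ∧ (∀ N, ∫ y, φ N y = 1) ∧ (∀ (N : ℕ) y, ((N : ℝ) + 1) ^ (-γ) ≤ Literature.Analysis.FluidPDE.Torus.euclidDist y 0 → φ N y = 0) ∧ (∀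 (N : ℕ) y, φ N y ≤ C * ((N : ℝ) + 1) ^ (3 * γ)) ∧ (∀ (N : ℕ) y, ‖Literature.Analysis.FunctionSpaces.Torus.gradient (φ N) y‖ ≤ C * ((N : ℝ) + 1) ^ (4 * γ))) → let T := UnitAddTorus (Fin 3); let Cfg := fun N => Literature.Analysis.FluidPDE.Config (N + 1) (Fin 3) T; let P := fun N => Literature.MathematicalPhysics.KineticTheory.localGibbsLaw σ a₀ u₀ θ₀ N (Φ N); let F := fun N (z : Cfg N) s => (Φ N).flow s z; let ρb := fun (χ : ℕ → T → ℝ) N (z : Cfg N) x => Literature.MathematicalPhysics.KineticTheory.empiricalDensityField z (fun y => χ N (y - x)); let mb := fun (χ : ℕ → T → ℝ) N (z : Cfg N) x => Literature.MathematicalPhysics.KineticTheory.empiricalMomentumField z (fun y => χ N (y - x)); let Eb := fun (χ : ℕ → T → ℝ) N (z : Cfg N) x => Literature.MathematicalPhysics.KineticTheory.empiricalEnergyField z (fun y => χ N (y - x)); let ub := fun (χ : ℕ → T → ℝ) N (z : Cfg N) x => (ρb χ N z x)⁻¹ • mb χ N z x; let θb := fun (χ : ℕ → T → ℝ) N (z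 : Cfg N) x => 2 / 3 * (Eb χ N z x / ρb χ N z x - ‖mb χ N z x‖ ^ 2 / (2 * ρb χ N z x ^ 2)); let pc := fun (r th : ℝ) => Literature.MathematicalPhysics.KineticTheory.hsPressure σ r th - r * th; let D := fun (χ : ℕ → T → ℝ) N (z : Cfg N) x j k => (∫ y, χ N (y.1 - x) * ((y.2 j - ub χ N z x j) * (y.2 k - ub χ N z x k)) ∂(Literature.Analysis.FluidPDE.empiricalMeasure z)) - (if j = k then (∑ l : Fin 3, ∫ y, χ N (y.1 - x) * (y.2 l - ub χ N z x l) ^ 2 ∂(Literature.Analysis.FluidPDE.empiricalMeasure z)) / 3 else 0); let V := fun (χ : ℕ → T → ℝ) (A : ℝ → T → Fin 3 → Fin 3 → ℝ) N (z : Cfg N) τ => (∫ s in Icc 0 τ, ∫ x, (∑ a, A s x a a) * pc (ρb χ N (F N z s) x) (θb χ N (F N z s) x)) + ∫ s in Icc 0 τ, ∫ x, 2 / 5 * (∑ a, ∑ b, D χ N (F N z s) x a b * A s x a b) / (ρb χ N (F N z s) x * θb χ N (F N z s) x) * pc (ρb χ N (F N z s) x) (θb χ N (F N z s) x); Tendsto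 (fun N : ℕ => P N {z | ∃ s ∈ Icc 0 t, ∃ x : T, η₁ < ρb φ N (F N z s) x * σ ^ 3}) atTop (𝓝 0) → ∀ (A : ℝ → T → Fin 3 → Fin 3 → ℝ), (∀ a b, Literature.Analysis.FunctionSpaces.Torus.IsSmoothSpaceTimeOn (Icc 0 t) (fun s x => A s x a b)) → ∀ τ ∈ Icc 0 t, ∀ η δ : ℝ, 0 < η → 0 < δ → ∃ r₀ : ℝ, 0 < r₀ ∧ ∀ r : ℝ, 0 < r → r < r₀ → ∃ N₀ : ℕ, ∀ N : ℕ, N₀ ≤ N → P N {z | η < |V (fun (_ : ℕ) (y : T) => Literature.MathematicalPhysics.KineticTheory.coneKernel r y 0) A N z τ - V φ A N z τ|} ≤ ENNReal.ofReal δ) →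
    (∀ (a₀ θ₀ : (UnitAddTorus (Fin 3)) → ℝ) (u₀ : (UnitAddTorus (Fin 3)) → (EuclideanSpace ℝ (Fin 3))), Continuous a₀ → Continuous θ₀ → Continuous u₀ → (∀ x, 0 < a₀ x) → (∀ x, 0 < θ₀ x) → ∃ σ₀ : ℝ, 0 < σ₀ ∧ ∃ η₁ : ℝ, 0 < η₁ ∧ ∀ σ : ℝ, 0 < σ → σ < σ₀ → ∀ Φ : (N : ℕ) → Literature.Analysis.FluidPDE.HardSphereFlow (Literature.Analysis.FluidPDE.Torus.geometry (Fin 3)) (Literature.MathematicalPhysics.KineticTheory.hsDiameter σ N) (N + 1), ∀ t : ℝ, 0 < t → let T := UnitAddTorus (Fin 3); let Cfg := fun N => Literature.Analysis.FluidPDE.Config (N + 1) (Fin 3) T; let P := fun N => Literature.MathematicalPhysics.KineticTheory.localGibbsLaw σ a₀ u₀ θ₀ N (Φ N); let F := fun N (z : Cfg N) s => (Φ N).flow s z; let ε := fun N => Literature.MathematicalPhysics.KineticTheory.hsDiameter σ N; let nrm := fun N (w : Cfg N) i j => (Literature.Analysis.FluidPDE.Torus.geometry (Fin 3)).sepVec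 (w i).1 (w j).1; let dv := fun N (w : Cfg N) i j => (w i).2 - (Literature.Analysis.FluidPDE.reflectVel (nrm N w i j) ((w i).2, (w j).2)).1; let V := fun N (z : Cfg N) τ => ((N : ℝ) + 1)⁻¹ * (Φ N).collisionPairSum (Ioc 0 τ) (fun _ (w : Cfg N) i j => ε N * ‖dv N w i j‖ * (1 + ‖(w i).2‖ + ‖(w j).2‖)) z; (∀ δ : ℝ, 0 < δ → ∃ K : ℝ, ∀ᶠ N : ℕ in atTop, P N {z | K < V N z t} ≤ ENNReal.ofReal δ) → ∀ (γ C : ℝ) (φ : ℕ → T → ℝ), 0 < γ → γ ≤ 1 / 15 → ((∀ N, Literature.Analysis.FunctionSpaces.Torus.IsSmooth (φ N)) ∧ (∀ N y, 0 ≤ φ N y) ∧ (∀ N, ∫ y, φ N y = 1) ∧ (∀ (N : ℕ) y, ((N : ℝ) + 1) ^ (-γ) ≤ Literature.Analysis.FluidPDE.Torus.euclidDist y 0 → φ N y = 0) ∧ (∀ (N : ℕ) y, φ N y ≤ C * ((N : ℝ) + 1) ^ (3 * γ)) ∧ (∀ (N : ℕ) y, ‖Literature.Analysis.FunctionSpaces.Torus.gradient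 (φ N) y‖ ≤ C * ((N : ℝ) + 1) ^ (4 * γ))) → let ρb := fun N (z : Cfg N) x => Literature.MathematicalPhysics.KineticTheory.empiricalDensityField z (fun y => φ N (y - x)); let mb := fun N (z : Cfg N) x => Literature.MathematicalPhysics.KineticTheory.empiricalMomentumField z (fun y => φ N (y - x)); let Eb := fun N (z : Cfg N) x => Literature.MathematicalPhysics.KineticTheory.empiricalEnergyField z (fun y => φ N (y - x)); let ub := fun N (z : Cfg N) x => (ρb N z x)⁻¹ • mb N z x; let θb := fun N (z : Cfg N) x => 2 / 3 * (Eb N z x / ρb N z x - ‖mb N z x‖ ^ 2 / (2 * ρb N z x ^ 2)); Tendsto (fun N : ℕ => P N {z | ∃ s ∈ Icc 0 t, ∃ x : T, η₁ < ρb N (F N z s) x * σ ^ 3}) atTop (𝓝 0) → ∀ χ : ℝ → T → ℝ, Literature.Analysis.FunctionSpaces.Torus.IsSmoothSpaceTimeOn (Icc 0 t) χ → let g := fun s (x : T) (a : Fin 3) => Literature.Analysis.FunctionSpaces.Torus.gradient (χ s) x a; let μ := fun N (z : Cfg N) => Literature.Analysis.FluidPDE.empiricalMeasure z; let D := fun N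 (z : Cfg N) x j k => (∫ y, φ N (y.1 - x) * ((y.2 j - ub N z x j) * (y.2 k - ub N z x k)) ∂(μ N z)) - (if j = k then (∑ l : Fin 3, ∫ y, φ N (y.1 - x) * (y.2 l - ub N z x l) ^ 2 ∂(μ N z)) / 3 else 0); let q := fun N (z : Cfg N) x => ∫ y, (φ N (y.1 - x) * ‖y.2 - ub N z x‖ ^ 2 / 2) • (y.2 - ub N z x) ∂(μ N z); let pc := fun N (w : Cfg N) x => Literature.MathematicalPhysics.KineticTheory.hsPressure σ (ρb N w x) (θb N w x) - ρb N w x * θb N w x; let ω := fun N (w : Cfg N) i j => ‖nrm N w i j‖⁻¹ • nrm N w i j; let M := fun N (z : Cfg N) τ => ((N : ℝ) + 1)⁻¹ * (Φ N).collisionPairSum (Ioc 0 τ) (fun s (w : Cfg N) i j => ε N / 2 * ‖dv N w i j‖ * (inner ℝ ((1 / 2 : ℝ) • ((w i).2 + (w j).2)) (ω N w i j) * ∑ a, ω N w i j a * g s (w i).1 a)) z; let W₁ := fun N (z : Cfg N) τ => ∫ s in Icc 0 τ, ∫ x, (∑ j, g s x j * ub N (F N z s) x j) * pc N (F N z s)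 x; let W₂ := fun N (z : Cfg N) τ => ∫ s in Icc 0 τ, ∫ x, (2 / 5 * (∑ a, ∑ b, D N (F N z s) x a b * ub N (F N z s) x b * g s x a) / (ρb N (F N z s) x * θb N (F N z s) x) + 3 / 5 * (∑ a, q N (F N z s) x a * g s x a) / (ρb N (F N z s) x * θb N (F N z s) x)) * pc N (F N z s) x; ∀ δ : ℝ, 0 < δ → Tendsto (fun N : ℕ => P N {z | ∃ τ ∈ Icc 0 t, δ < |M N z τ - (W₁ N z τ + W₂ N z τ)|}) atTop (𝓝 0)) →
    (∀ η₁ : ℝ, 0 < η₁ → ∀ (a₀ θ₀ : (UnitAddTorus (Fin 3)) → ℝ) (u₀ : (UnitAddTorus (Fin 3)) → (EuclideanSpace ℝ (Fin 3))), Continuous a₀ → Continuous θ₀ → Continuous u₀ → (∀ x, 0 < a₀ x) → (∀ x, 0 < θ₀ x) → ∃ σ₀ : ℝ, 0 < σ₀ ∧ ∀ σ : ℝ, 0 < σ → σ < σ₀ → ∀ Φ : (N : ℕ) → Literature.Analysis.FluidPDE.HardSphereFlow (Literature.Analysis.FluidPDE.Torus.geometry (Fin 3)) (Literature.MathematicalPhysics.KineticTheory.hsDiameter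 σ N) (N + 1), ∀ t : ℝ, 0 < t → ∀ (γ C : ℝ) (φ : ℕ → (UnitAddTorus (Fin 3)) → ℝ), 0 < γ → γ ≤ 1 / 15 → ((∀ N, Literature.Analysis.FunctionSpaces.Torus.IsSmooth (φ N)) ∧ (∀ N y, 0 ≤ φ N y) ∧ (∀ N, ∫ y, φ N y = 1) ∧ (∀ (N : ℕ) y, ((N : ℝ) + 1) ^ (-γ) ≤ Literature.Analysis.FluidPDE.Torus.euclidDist y 0 → φ N y = 0) ∧ (∀ (N : ℕ) y, φ N y ≤ C * ((N : ℝ) + 1) ^ (3 * γ)) ∧ (∀ (N : ℕ) y, ‖Literature.Analysis.FunctionSpaces.Torus.gradient (φ N) y‖ ≤ C * ((N : ℝ) + 1) ^ (4 * γ))) → Tendsto (fun N : ℕ => Literature.MathematicalPhysics.KineticTheory.localGibbsLaw σ a₀ u₀ θ₀ N (Φ N) {z | ∃ s ∈ Icc 0 t, ∃ x : (UnitAddTorus (Fin 3)), η₁ < Literature.MathematicalPhysics.KineticTheory.empiricalDensityField ((Φ N).flow s z) (fun y => φ N (y - x)) * σ ^ 3}) atTop (𝓝 0)) →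
    Summit.AtomisticToContinuum.HydrodynamicLimit.Theses.CollisionIsometryCLT.CollisionalTransferLocality := by
  intro hF hM h79 hTS hKq hS
  show Summit.AtomisticToContinuum.HydrodynamicLimit.Theses.StiffCollisionalRelaxation.CollisionalTransferLocality
  refine HemisphereAffineSlaving.collisionalTransferLocality_of_items_c10 hF hM h79 ?_ ?_ ?_
  · exact HemisphereAffineSlaving.twoScaleValueRegularity_iff_inline.1 hTS
  · exact HemisphereAffineSlaving.collisionalEnergyFluxLaw_iff_inline.1 hKq
  · intro η₁ hη₁ a₀ θ₀ u₀ hP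
    obtain ⟨ha, hθ, hu, ha0, hθ0⟩ := hP
    obtain ⟨σ₀, hσ₀, H⟩ := hS η₁ hη₁ a₀ θ₀ u₀ ha hθ hu ha0 hθ0
    exact ⟨σ₀, hσ₀, fun σ hσ hσ' Φ t ht γ C φ hγ hγ' hadm => H σ hσ hσ' Φ t ht γ C φ hγ hγ' hadm⟩

/-- **Proof of the generated glue item `CollisionIsometryCLT.CollisionalTransferLocalityGlue` (stmt-AtomisticToContinuum-18220), BY NAME**
(route CollisionIsometryCLT rev 15): the children's route decls are consumed by definitional unfolding. PROVER: propose this file verbatim as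
`Theorems/CollisionIsometryCLTCollisionalTransferLocalityGlue.lean --workitem stmt-AtomisticToContinuum-18220` (lean check rc0, axioms
propext / Classical.choice / Quot.sound, audit `proof-of-item`). -/
theorem collisionalTransferLocalityGlue_proof :
    Summit.AtomisticToContinuum.HydrodynamicLimit.Theses.CollisionIsometryCLT.CollisionalTransferLocalityGlue :=
  fun h₁ h₂ h₃ h₄ h₅ h₆ => collisionalTransferLocality_of_subs_cic h₁ h₂ h₃ h₄ h₅ h₆

end

end Summit.AtomisticToContinuum.HydrodynamicLimit.Theorems
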